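import Literature.Probability.Percolation.Z2PivotalMeasure
import Literature.Probability.Percolation.FourArmGarban
import HarnessLib
import Summits.CriticalPhenomena.CardyFormulaZ2.Theorems.CardyMeckeFlipFlipErgodicityZ2StubLatticeSecondMomentReduction
import Summits.CriticalPhenomena.CardyFormulaZ2.Theorems.CardyMeckeFlipFlipErgodicityZ2StubLatticeSecondMomentInnerSum
import Summits.CriticalPhenomena.CardyFormulaZ2.Theorems.CardyMeckeFlipFlipErgodicityZ2StubLatticeSecondMomentScales
import Summits.CriticalPhenomena.CardyFormulaZ2.Theorems.CardyMeckeFlipFlipErgodicityZ2StubLatticeSecondMomentEdgeArmPos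
import Literature.Probability.Percolation.ZdFourArmQuasiMult

/-!
# Crux `FlipErgodicityZ2` (stmt-CriticalPhenomena-14825), line `registered`, stub
# `stub_latticeSecondMoment`: the uniform second moment from quasi-multiplicativity

Route `Summits/CriticalPhenomena/CardyFormulaZ2/Theses/CardyMeckeFlip`.  The registered stub
`stub_latticeSecondMoment` asks for the uniform second-moment bound

  `∀ ε > 0, ∀ φ ∈ C_c(ℂ), ∃ C δ₀ > 0, ∀ δ ∈ (0, δ₀], E_{1/2}[(∫ |φ| dμ^ε_δ)²] ≤ C`

for the isometry-averaged Garban–Pete–Schramm pivotal measures `μ^ε_δ = z2PivotalMeasure ε δ` of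
bond percolation on `δℤ²` (node B2 of the line: GPS 2013, arXiv:1008.1378, §4.3–4.6, "there is
some universal constant `C > 0` such that `E[X²] ≤ C E[X]²` … these well-known second moment
calculations", transplanted to bond-`ℤ²`).  Already the FIRST moment is uniformly bounded only
through the hard direction of four-arm QUASI-MULTIPLICATIVITY for bond-`ℤ²` at `p = 1/2`, and
the second moment needs in addition the a priori lower bound `α₄(r,R) ≥ c (r/R)^{2-η}`, `η > 0`.
Neither is in the tree for bond-`ℤ²` (the tree has the site-`𝕋` renderings
`Werner2009_fourArm_quasiMult`, `Werner2009_fourArm_lowerBound`).  This file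

* states the three printed bond-`ℤ²` inputs as named facts, in the tree's cluster-form
  vocabulary (`edgeFourArm`, `fourArmTwoClusters`, `bondPercolation (zdGraph 2) half`):
  `Nolin2008_zdEdgeFourArmQuasiMult` (quasi-multiplicativity with the inner annulus shrunk to an
  edge — Nolin 2008 Prop. 17 with `n₁ = n₀(4) = 0`, §8.1; GPS 2013 §2.1),
  `DuminilCopinManolescuTassion2021_zdFourArm_quasiMult` (Prop. 6.3, `q = 1`, `σ = 1010`),
  `DuminilCopinManolescuTassion2021_zdFourArm_lowerBound` (Prop. 6.8, `q = 1`);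
* PROVES the registered statement from them: `latticeSecondMoment_of_quasiMult`.

Proof (GPS 2013 §4.3–4.4 / Kesten 1987, bond-`ℤ²`, cluster form), assembled from the helper
files of the stub: `∫ |φ| dμ^ε_δ ≤ ‖φ‖_∞ Σ_e w_e` and `w_e ≤ r(δ) 1_{A_e}`, `A_e` = four arms from
`e` to the boundary of the box of radius `m ≍ ε/δ` around it (`…Reduction`); the pair
probabilities `P(A_e ∩ A_{e'})` by independence over three disjoint regions (`…PairBound`); the
NEAR/MID/FAR summation over `e'` with the arm algebra and `Σ ℓ^{η-1} ≤ M^η/η` (`…InnerSum`,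
`…Sums`); the mesh bookkeeping `n = ⌊1/δ⌋`, `m = ⌊min(ε,2)n/4⌋`, `|E| ≤ C n²`,
`r(δ) ≤ 1/(n² a(n))` (`…Scales`); positivity `a(N₀) > 0` (`…EdgeArmPos`).  The resulting bound is
`(‖φ‖_∞ r(δ))² · |E| · (c₁ a(m) + c₂ n² a(n) a(m) + |E| c₃ a(m)²) ≤ C(ε, φ)` uniformly in `δ`,
because `a(m) ≤ ρ a(n)` (quasi-multiplicativity at ratio `m/n ≥ min(ε,2)/8`) and `n² a(n) ≥ κ > 0`.
-/

noncomputable section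

open MeasureTheory Set Filter Topology
open Literature.Probability.Percolation Literature.Probability.Percolation.QuadCrossing
open Literature.Probability.LatticeModels
open scoped ENNReal

namespace Summit.CriticalPhenomena.CardyFormulaZ2.Theorems.CardyMeckeFlip

/-! ### The three printed inputs, bond-`ℤ²` at `p = 1/2`, cluster form -/

/-- The lower bound fact in the form (Q3) used by the arm algebra: exponent defect
`η = min c 1 ∈ (0,1]`. [folklore] -/
theorem zdFourArm_lowerBound_eta (h : Literature.Probability.Percolation.DuminilCopinManolescuTassion2021_zdFourArm_lowerBound) :
    ∃ cL η : ℝ, 0 < cL ∧ 0 < η ∧ η ≤ 1 ∧ ∀ r R : ℕ, 1 ≤ r → r ≤ R →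
      cL * ((r : ℝ) / R) ^ (2 - η) ≤
        (bondPercolation (zdGraph 2) half).real (fourArmTwoClusters r R) := by
  obtain ⟨c, hc, h⟩ := h
  refine ⟨c, min c 1, hc, lt_min hc one_pos, min_le_right _ _, fun r R hr hrR => ?_⟩
  refine le_trans (mul_le_mul_of_nonneg_left ?_ hc.le) (h r R hr hrR)
  have hR : (0 : ℝ) < R := by exact_mod_cast (hr.trans hrR)
  have hq0 : 0 < (r : ℝ) / R := div_pos (by exact_mod_cast hr) hR
  have hq1 : (r : ℝ) / R ≤ 1 := by rw [div_le_one hR]; exact_mod_cast hrR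
  exact Real.rpow_le_rpow_of_exponent_ge hq0 hq1 (by linarith [min_le_left c 1])

/-- **The final arithmetic of the second-moment computation** (pure real algebra): with
`r ≤ X = 1/(n² a(n))`, `S ≤ |E| (c₁ a(m) + c₂ n² a(n) a(m) + |E| c₃ a(m)²)`, `|E| ≤ K_E n²`,
`a(m) ≤ ρ a(n)` and `κ ≤ n² a(n)`, one gets `(B r)² S ≤ B² K_E (c₁ ρ/κ + c₂ ρ + K_E c₃ ρ²)`.
[folklore] -/
theorem secondMoment_arith {B r X S cardE KE nn an am c₁ c₂ c₃ ρ κ : ℝ} (hB0 : 0 ≤ B)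
    (hr0 : 0 ≤ r) (hrX : r ≤ X) (hXid : X * (nn * an) = 1) (hS0 : 0 ≤ S)
    (hS : S ≤ cardE * (c₁ * am + c₂ * (nn * (an * am)) + cardE * (c₃ * am ^ 2)))
    (hcard0 : 0 ≤ cardE) (hcard : cardE ≤ KE * nn) (hKE0 : 0 ≤ KE) (hnn : 0 ≤ nn) (han : 0 < an)
    (ham : 0 ≤ am) (hratio : am ≤ ρ * an) (hc₁0 : 0 ≤ c₁) (hc₂0 : 0 ≤ c₂) (hc₃0 : 0 ≤ c₃)
    (hρ0 : 0 ≤ ρ) (hκ0 : 0 < κ) (hfloor : κ ≤ nn * an) :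
    (B * r) ^ 2 * S ≤ B ^ 2 * (KE * (c₁ * ρ / κ + c₂ * ρ + KE * c₃ * ρ ^ 2)) := by
  have hT : cardE * (c₁ * am + c₂ * (nn * (an * am)) + cardE * (c₃ * am ^ 2)) ≤
      (KE * nn) * (c₁ * (ρ * an) + c₂ * (nn * (an * (ρ * an))) + (KE * nn) * (c₃ * (ρ * an) ^ 2)) := by
    have h1 : c₁ * am ≤ c₁ * (ρ * an) := mul_le_mul_of_nonneg_left hratio hc₁0
    have h2 : c₂ * (nn * (an * am)) ≤ c₂ * (nn * (an * (ρ * an))) :=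
      mul_le_mul_of_nonneg_left (mul_le_mul_of_nonneg_left
        (mul_le_mul_of_nonneg_left hratio han.le) hnn) hc₂0
    have h3 : cardE * (c₃ * am ^ 2) ≤ (KE * nn) * (c₃ * (ρ * an) ^ 2) :=
      mul_le_mul hcard (mul_le_mul_of_nonneg_left (pow_le_pow_left₀ ham hratio 2) hc₃0)
        (mul_nonneg hc₃0 (sq_nonneg _)) (by positivity)
    have hsum0 : 0 ≤ c₁ * am + c₂ * (nn * (an * am)) + cardE * (c₃ * am ^ 2) := by
      positivity
    exact mul_le_mul hcard (add_le_add (add_le_add h1 h2) h3) hsum0 (by positivity)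
  have hlast : c₁ * ρ * X ≤ c₁ * ρ / κ := by
    have hXeq : X = 1 / (nn * an) := by
      have hna : nn * an ≠ 0 := fun h => by rw [h, mul_zero] at hXid; exact zero_ne_one hXid
      exact (eq_div_iff hna).2 hXid
    rw [hXeq, mul_one_div]
    exact div_le_div_of_nonneg_left (by positivity) hκ0 hfloor
  calc (B * r) ^ 2 * S
      ≤ (B * X) ^ 2 * (cardE * (c₁ * am + c₂ * (nn * (an * am)) + cardE * (c₃ * am ^ 2))) :=
        mul_le_mul (pow_le_pow_left₀ (mul_nonneg hB0 hr0) (mul_le_mul_of_nonneg_left hrX hB0) 2)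
          hS hS0 (by positivity)
    _ ≤ (B * X) ^ 2 *
          ((KE * nn) * (c₁ * (ρ * an) + c₂ * (nn * (an * (ρ * an))) + (KE * nn) * (c₃ * (ρ * an) ^ 2))) :=
        mul_le_mul_of_nonneg_left hT (by positivity)
    _ = B ^ 2 * (KE * (c₁ * ρ * X + c₂ * ρ + KE * c₃ * ρ ^ 2)) := by
        linear_combination (B ^ 2 * KE * (c₁ * ρ * X +
          (c₂ * ρ + KE * c₃ * ρ ^ 2) * (X * (nn * an) + 1))) * hXid
    _ ≤ B ^ 2 * (KE * (c₁ * ρ / κ + c₂ * ρ + KE * c₃ * ρ ^ 2)) :=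
        mul_le_mul_of_nonneg_left (mul_le_mul_of_nonneg_left
          (add_le_add (add_le_add hlast le_rfl) le_rfl) hKE0) (sq_nonneg B)

/-- **The uniform second moment of the GPS pivotal measures of bond-`ℤ²` from the three printed
arm estimates** (node B2 of the line; GPS 2013 §4.3–4.4: "`E[X²] ≤ C E[X]²`,
`E[X²] ≍ η⁻⁴ α₄^η(η,1)²`", transplanted to bond-`ℤ²`): assuming edge quasi-multiplicativity,
annulus quasi-multiplicativity and the four-arm lower bound with exponent `< 2`, for every
`ε > 0` and `φ ∈ C_c(ℂ)` there are `C` and `δ₀ > 0` with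
`E_{1/2}[(∫ |φ| dμ^ε_δ)²] ≤ C` for all `0 < δ ≤ δ₀` — verbatim the registered signature of
`stub_latticeSecondMoment` as conclusion. [cite: GarbanPeteSchramm2013Pivotal, §4.3–4.4 (second moment estimates, (4.9))] -/
theorem latticeSecondMoment_of_quasiMult :
    Literature.Probability.Percolation.Nolin2008_zdEdgeFourArmQuasiMult → Literature.Probability.Percolation.DuminilCopinManolescuTassion2021_zdFourArm_quasiMult →
      Literature.Probability.Percolation.DuminilCopinManolescuTassion2021_zdFourArm_lowerBound →
        ∀ ε : ℝ, 0 < ε → ∀ φ : ℂ → ℝ, Continuous φ → HasCompactSupport φ →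
          ∃ C δ₀ : ℝ, 0 < δ₀ ∧ ∀ δ : ℝ, 0 < δ → δ ≤ δ₀ →
            ∫ ω, (∫ x, |φ x| ∂(z2PivotalMeasure ε δ ω)) ^ 2 ∂(bondPercolation (zdGraph 2) half) ≤ C := by
  intro hQM hQM2 hLB ε hε φ hφ hφc
  -- notation
  set P := bondPercolation (zdGraph 2) half with hP
  set a : ℕ → ℝ := fun N => P.real (edgeFourArm (↑(box 2 N) : Set (Site 2)) 0 0) with ha
  set α : ℕ → ℕ → ℝ := fun r R => P.real (fourArmTwoClusters r R) with hα
  have ha0 : ∀ N, 0 ≤ a N := fun N => measureReal_nonneg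
  -- the three facts, with `N₀ ≥ 1` and `η ≤ 1`
  obtain ⟨N₀', cQ, hcQ, hQ1'⟩ := hQM
  set N₀ : ℕ := max N₀' 1 with hN₀def
  have hN₀ : 1 ≤ N₀ := le_max_right _ _
  have hQ1 : ∀ m N : ℕ, N₀ ≤ m → m < N → cQ * (a m * α m N) ≤ a N := fun m N hm hmN =>
    hQ1' m N ((le_max_left _ _).trans hm) hmN
  obtain ⟨CQ, hCQ, hQ2⟩ := hQM2
  have hQ2' : ∀ r ρ R : ℕ, 1 ≤ r → r ≤ ρ → ρ ≤ R → α r ρ * α ρ R ≤ CQ * α r R := hQ2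
  obtain ⟨cL, η, hcL, hη0, hη1, hQ3⟩ := zdFourArm_lowerBound_eta hLB
  have hQ3' : ∀ r R : ℕ, 1 ≤ r → r ≤ R → cL * ((r : ℝ) / R) ^ (2 - η) ≤ α r R := hQ3
  -- the test function: bound and support
  obtain ⟨B, hB⟩ := hφ.bounded_above_of_compact_support hφc
  have hB' : ∀ z, |φ z| ≤ B := fun z => by rw [← Real.norm_eq_abs]; exact hB z
  have hB0 : 0 ≤ B := (abs_nonneg _).trans (hB' 0)
  obtain ⟨R₀', hR₀'⟩ := hφc.isCompact.isBounded.subset_closedBall (0 : ℂ)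
  set R₀ : ℝ := max R₀' 0 with hR₀def
  have hR₀ : 0 ≤ R₀ := le_max_right _ _
  have hsupp : tsupport φ ⊆ Metric.closedBall (0 : ℂ) R₀ :=
    hR₀'.trans (Metric.closedBall_subset_closedBall (le_max_left _ _))
  -- constants
  set ε' : ℝ := min ε 2 with hε'
  have hε'0 : 0 < ε' := lt_min hε two_pos
  set δ₀ : ℝ := ε' / (40 * ((N₀ + 1 : ℕ) : ℝ)) with hδ₀
  have hδ₀pos : 0 < δ₀ := by positivity
  have hδ₀1 : δ₀ ≤ 1 := by
    rw [hδ₀, div_le_one (by positivity)]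
    have : ε' ≤ 2 := min_le_right _ _
    have : (2 : ℝ) ≤ ((N₀ + 1 : ℕ) : ℝ) := by exact_mod_cast (show 2 ≤ N₀ + 1 by omega)
    linarith
  set κ : ℝ := cQ * cL * a N₀ with hκ
  have haN₀ : 0 < a N₀ := real_edgeFourArm_box_pos N₀ hN₀
  have hκ0 : 0 < κ := by positivity
  set ρ : ℝ := 1 / (cQ * cL * (ε' / 8) ^ 2) with hρ
  have hρ0 : 0 < ρ := by positivity
  set KE : ℝ := 50 * ((⌈R₀⌉₊ : ℝ) + 1) ^ 2 with hKE
  have hKE0 : 0 ≤ KE := by positivity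
  set c₁ : ℝ := 2 * (2 * ((2 * N₀ + 6 : ℕ) : ℝ) + 1) ^ 2 with hc₁
  set c₂ : ℝ := 256 * (16 * CQ / (cQ ^ 2 * cL ^ 2)) / η with hc₂
  set c₃ : ℝ := (256 / (cQ * cL)) ^ 2 with hc₃
  have hc₁0 : 0 ≤ c₁ := by positivity
  have hc₂0 : 0 ≤ c₂ := by positivity
  have hc₃0 : 0 ≤ c₃ := by positivity
  refine ⟨B ^ 2 * (KE * (c₁ * ρ / κ + c₂ * ρ + KE * c₃ * ρ ^ 2)), δ₀, hδ₀pos, fun δ hδ hδδ₀ => ?_⟩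
  -- the scales (opaque names with defining equations, to keep unification cheap)
  obtain ⟨n, hn⟩ : ∃ n : ℕ, n = ⌊δ⁻¹⌋₊ := ⟨_, rfl⟩
  obtain ⟨m, hm⟩ : ∃ m : ℕ, m = ⌊min ε 2 * n / 4⌋₊ := ⟨_, rfl⟩
  obtain ⟨hn1, hnle, hm8, hmn, hmn', h2δm⟩ :=
    scales_of_small_mesh ε δ (N₀ + 1) n m (by omega) hε hδ hδδ₀ hn hm
  have hδ1 : δ ≤ 1 := hδδ₀.trans hδ₀1
  have hm1 : 1 ≤ m := by omega
  have hmN₀ : N₀ ≤ m := by omega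
  have hN₀n : N₀ < n := by omega
  have hn0 : (0 : ℝ) < n := by exact_mod_cast hn1
  -- the arm comparisons
  have hfloor : κ ≤ (n : ℝ) ^ 2 * a n := armAlgebra_floor hcQ hcL hη0.le ha0 hQ1 hQ3' hN₀ hN₀n
  have han : 0 < a n := by
    have : 0 < (n : ℝ) ^ 2 * a n := hκ0.trans_le hfloor
    exact pos_of_mul_pos_right this (by positivity)
  have ham : 0 ≤ a m := ha0 m
  have hratio : a m ≤ ρ * a n := by
    have := armAlgebra_ratio hcQ hcL hη0.le ha0 hQ1 hQ3' hm1 hmN₀ hmn (by positivity) hmn'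
    rw [hρ, one_div, inv_mul_eq_div, le_div_iff₀ (by positivity)]
    calc a m * (cQ * cL * (ε' / 8) ^ 2) = cQ * cL * (ε' / 8) ^ 2 * a m := by ring
      _ ≤ a n := this
  -- the charged edges
  have hfin := finite_setOf_edgeMidpoint_mem (T := Metric.closedBall (0 : ℂ) R₀)
    Metric.isBounded_closedBall hδ
  set E : Finset (Site 2 × Fin 2) := hfin.toFinset with hEdef
  have hE : ∀ p : Site 2 × Fin 2, φ (edgeMidpoint δ p.1 p.2) ≠ 0 → p ∈ E := fun p hp =>
    hfin.mem_toFinset.2 (hsupp (subset_tsupport φ (Function.mem_support.2 hp)))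
  have hEball : ∀ p ∈ E, edgeMidpoint δ p.1 p.2 ∈ Metric.closedBall (0 : ℂ) R₀ := fun p hp =>
    hfin.mem_toFinset.1 hp
  have hcardE : (E.card : ℝ) ≤ KE * (n : ℝ) ^ 2 := by
    have h := card_edges_le hδ hδ1 hR₀ E hEball
    rw [← hn] at h
    exact h
  -- the reduction to pair probabilities
  have hred := integral_sq_le_sum_pairs_shiftBox ε δ m hδ hm1 h2δm φ hφ hφc B hB' E hE
  -- the sum over pairs
  have hpairs : ∑ p ∈ E, ∑ q ∈ E, P.real
      (edgeFourArm {u : Site 2 | u - p.1 ∈ box 2 m} p.1 p.2 ∩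
        edgeFourArm {u : Site 2 | u - q.1 ∈ box 2 m} q.1 q.2) ≤
      (E.card : ℝ) * (c₁ * a m + c₂ * ((n : ℝ) ^ 2 * (a n * a m)) + (E.card : ℝ) * (c₃ * a m ^ 2)) := by
    have hinner : ∀ p ∈ E, ∑ q ∈ E, P.real
        (edgeFourArm {u : Site 2 | u - p.1 ∈ box 2 m} p.1 p.2 ∩
          edgeFourArm {u : Site 2 | u - q.1 ∈ box 2 m} q.1 q.2) ≤
        c₁ * a m + c₂ * ((n : ℝ) ^ 2 * (a n * a m)) + (E.card : ℝ) * (c₃ * a m ^ 2) :=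
      fun p _ => sum_pairs_le_of_quasiMult hN₀ hcQ hCQ hcL hη0 hη1 hQ1 hQ2' hQ3'
        (by omega) hmn p.1 p.2 E
    calc _ ≤ ∑ p ∈ E, (c₁ * a m + c₂ * ((n : ℝ) ^ 2 * (a n * a m)) + (E.card : ℝ) * (c₃ * a m ^ 2)) :=
          Finset.sum_le_sum hinner
      _ = _ := by rw [Finset.sum_const, nsmul_eq_mul]
  -- the rate, with `X = 1/(n² a(n))` opaque
  obtain ⟨X, hX⟩ : ∃ X : ℝ, X = 1 / ((n : ℝ) ^ 2 * a n) := ⟨_, rfl⟩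
  have hXid : X * ((n : ℝ) ^ 2 * a n) = 1 := by
    rw [hX]
    field_simp
  have hrate : pivotalRate δ ≤ X := by
    have han2 : 0 < (bondPercolation (zdGraph 2) half).real
        (edgeFourArm (↑(box 2 ⌊δ⁻¹⌋₊) : Set (Site 2)) 0 0) := by
      rw [← hn]; exact han
    have h := pivotalRate_le hδ hδ1 han2
    rw [← hn] at h
    rw [hX]
    exact h
  have hrate0 : 0 ≤ pivotalRate δ := pivotalRate_nonneg δ
  -- assembly
  have hS0 : 0 ≤ ∑ p ∈ E, ∑ q ∈ E, P.real
      (edgeFourArm {u : Site 2 | u - p.1 ∈ box 2 m} p.1 p.2 ∩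
        edgeFourArm {u : Site 2 | u - q.1 ∈ box 2 m} q.1 q.2) :=
    Finset.sum_nonneg fun p _ => Finset.sum_nonneg fun q _ => measureReal_nonneg
  calc ∫ ω, (∫ x, |φ x| ∂(z2PivotalMeasure ε δ ω)) ^ 2 ∂P
      ≤ (B * pivotalRate δ) ^ 2 * ∑ p ∈ E, ∑ q ∈ E, P.real
          (edgeFourArm {u : Site 2 | u - p.1 ∈ box 2 m} p.1 p.2 ∩
            edgeFourArm {u : Site 2 | u - q.1 ∈ box 2 m} q.1 q.2) := hred
    _ ≤ B ^ 2 * (KE * (c₁ * ρ / κ + c₂ * ρ + KE * c₃ * ρ ^ 2)) :=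
        secondMoment_arith hB0 hrate0 hrate hXid hS0 hpairs (Nat.cast_nonneg _) hcardE hKE0
          (by positivity) han ham
          hratio hc₁0 hc₂0 hc₃0 hρ0.le hκ0 hfloor

end Summit.CriticalPhenomena.CardyFormulaZ2.Theorems.CardyMeckeFlip

end
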